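import Summits.MatrixMultiplication.OmegaCensus.SmallFormats.MatMul22nRankGF7Slack5Search
import HarnessLib

/-!
# ω-census family (a): replay of the slack-5 search certificate, CHECK A part 5 of 12 (elements `112 ≤ h < 140`)

Cell `pub-omega` (unit `pub-omega-tensor-g16`), topic `Summits/MatrixMultiplication/OmegaCensus` (sub-folder `SmallFormats`).
Framing (verbatim): lottery ticket; floor = certified bounds/negative ranges. HONEST FRAMING: machine-generated kernel replay
(`pub-omega-tensor-g16/code/gen5_runs.py`): `levelsOK5n h = true` for the elements `112 ≤ h < 140` of `PGL₂(7)`: for every slot `(c, h)`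
(`c < 656`) and bucket level, if the key of its column is visited then the bucket holds an entry with that column (SIMD key planes,
`MatMul22nRankGF7Plane`). Meaning: `slotOK5_of_levelsOK5` (`MatMul22nRankGF7Slack5SearchSound`). Nothing here is progress on `ω`.
-/

namespace Summit.MatrixMultiplication.OmegaCensus.SmallFormats

set_option Elab.async false

set_option maxRecDepth 100000 in
set_option maxHeartbeats 400000000 in
/-- Elements `112 ≤ h < 116`. -/
theorem levelsOK5_ok_112_116 : ∀ h : Fin 336, 112 ≤ h.val → h.val < 116 → levelsOK5n h.val = true := by decide +kernel

set_option maxRecDepth 100000 in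
set_option maxHeartbeats 400000000 in
/-- Elements `116 ≤ h < 120`. -/
theorem levelsOK5_ok_116_120 : ∀ h : Fin 336, 116 ≤ h.val → h.val < 120 → levelsOK5n h.val = true := by decide +kernel

set_option maxRecDepth 100000 in
set_option maxHeartbeats 400000000 in
/-- Elements `120 ≤ h < 124`. -/
theorem levelsOK5_ok_120_124 : ∀ h : Fin 336, 120 ≤ h.val → h.val < 124 → levelsOK5n h.val = true := by decide +kernel

set_option maxRecDepth 100000 in
set_option maxHeartbeats 400000000 in
/-- Elements `124 ≤ h < 128`. -/
theorem levelsOK5_ok_124_128 : ∀ h : Fin 336, 124 ≤ h.val → h.val < 128 → levelsOK5n h.val = true := by decide +kernel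

set_option maxRecDepth 100000 in
set_option maxHeartbeats 400000000 in
/-- Elements `128 ≤ h < 132`. -/
theorem levelsOK5_ok_128_132 : ∀ h : Fin 336, 128 ≤ h.val → h.val < 132 → levelsOK5n h.val = true := by decide +kernel

set_option maxRecDepth 100000 in
set_option maxHeartbeats 400000000 in
/-- Elements `132 ≤ h < 136`. -/
theorem levelsOK5_ok_132_136 : ∀ h : Fin 336, 132 ≤ h.val → h.val < 136 → levelsOK5n h.val = true := by decide +kernel

set_option maxRecDepth 100000 in
set_option maxHeartbeats 400000000 in
/-- Elements `136 ≤ h < 140`. -/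
theorem levelsOK5_ok_136_140 : ∀ h : Fin 336, 136 ≤ h.val → h.val < 140 → levelsOK5n h.val = true := by decide +kernel

/-- CHECK A for the elements `112 ≤ h < 140`. -/
theorem levelsOK5_run_5 : ∀ h : Fin 336, 112 ≤ h.val → h.val < 140 → levelsOK5n h.val = true := by
  intro h hlo hhi
  by_cases h116 : h.val < 116
  · exact levelsOK5_ok_112_116 h (by omega) h116
  by_cases h120 : h.val < 120
  · exact levelsOK5_ok_116_120 h (by omega) h120
  by_cases h124 : h.val < 124
  · exact levelsOK5_ok_120_124 h (by omega) h124
  by_cases h128 : h.val < 128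
  · exact levelsOK5_ok_124_128 h (by omega) h128
  by_cases h132 : h.val < 132
  · exact levelsOK5_ok_128_132 h (by omega) h132
  by_cases h136 : h.val < 136
  · exact levelsOK5_ok_132_136 h (by omega) h136
  exact levelsOK5_ok_136_140 h (by omega) hhi

end Summit.MatrixMultiplication.OmegaCensus.SmallFormats
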